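import Summits.HodgeConjecture.HodgeConjecture.Theorems.SectorComplement.Negative.ReductionToSummit
import Literature.AlgebraicGeometry.HodgeTheory.HodgeModelExistence

/-!
# `SectorComplement`: anatomy of the frame and the shape of any kill (negative-side lemmas, cycle 2)

Refuter lane `Theorems/SectorComplement/Negative/` for the crux
`EndoscopicMiddleDegree.SectorComplement := MiddleDegreeStep → HodgeConjecture`
(stmt-HodgeConjecture-14353), continuing `ReductionToSummit` (`¬ SectorComplement ↔ MiddleDegreeStep ∧ ¬ HC`).
No Theses decl is asserted; every statement is a negation, an equivalence, or a lemma about the summit's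
own definitional stack. No new `def … : Prop` is introduced: the three propositions used repeatedly are
written out —
* "full HC on the sector" `S := ∀ m X, 1 ≤ m → m ≤ 2 → Nonempty (UnitaryBallQuotientDatum (2(m+1)) X) →
  HodgeConjectureFor (2(m+1)) X`;
* "honest counterexample" `∃ n X p c, IsSmoothProjective n X ∧ IsRationalClass c ∧ IsOfHodgeType n X (2p) p p c ∧
  c ∉ algebraicClasses X p`;
* "model-less variety" `∃ n X, IsSmoothProjective n X ∧ IsEmpty (HodgeModel n X)`.

Findings (all sorry-free):
* `sectorComplement_iff_offSector_and_calibration`: the frame is EXACTLY "S → HC" (honest off-sector HC)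
  ∧ "MiddleDegreeStep → S" (on-sector calibration); `sectorHC_of_middleDegreeStep_of_binders` derives the
  calibration from four printed theorems taken as binders — Lefschetz (1,1), the hard-Lefschetz reduction,
  Hodge models, and HC in DEGREE 4 on 6-dimensional compact arithmetic ball quotients (BMM Cor. 2 at
  (p, n) = (6, 2)), the last being on-sector content of the frame that is not an item of the route.
* `not_offSectorFrame_iff`: even the honest part fails iff `S ∧ ¬ HC`.
* `not_hodgeConjecture_iff_modelless_or_honest`: a formal `¬ HC` is a model-less smooth projective variety
  (the anti-vacuity conjunct failing — junk) or an honest non-algebraic rational Hodge class; the junk branch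
  is closed by the named fact `nonempty_hodgeModel` (`not_modelless_of_nonempty_hodgeModel`), whence
  `not_sectorComplement_iff_of_nonempty_hodgeModel : ¬ SectorComplement ↔ MiddleDegreeStep ∧ honest cex`.
* `not_sectorComplement_of_inhabited_modelless_sector`: the ONE junk world killing the crux outright (an
  inhabited sector without Hodge models: the target is then vacuous because `IsOfHodgeType` is
  `∃ A : HodgeModel …`, and HC fails at the datum's `isSmoothProjective`), and its exclusion by the same fact
  (`not_modelless_inhabited_sector_of_nonempty_hodgeModel`).
* `sectorComplement_iff_not_hc_imp` : `SectorComplement ↔ (¬ HC → ¬ MiddleDegreeStep)` — the frame says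
  compact arithmetic 4- and 6-ball quotients are a universal test family for HC.
-/

set_option linter.dupNamespace false

namespace Summit.HodgeConjecture.HodgeConjecture.Theorems.SectorComplement.Negative

open Summit.HodgeConjecture.HodgeConjecture.Theses.EndoscopicMiddleDegree
open Literature.AlgebraicGeometry.HodgeTheory Literature.AlgebraicGeometry.Motives
  Literature.AlgebraicGeometry.ShimuraVarieties

/-! ## Anatomy: honest off-sector part ∧ on-sector calibration -/

/-- HC implies full HC on the sector (the datum records `IsSmoothProjective`). [folklore] -/
theorem sectorHC_of_hodgeConjecture (h : _root_.HodgeConjecture) :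
    ∀ (m : ℕ) (X : SchemeOver ℂ), 1 ≤ m → m ≤ 2 →
      Nonempty (UnitaryBallQuotientDatum (2 * (m + 1)) X) → HodgeConjectureFor (2 * (m + 1)) X := by
  rintro m X - - ⟨D⟩
  exact h D.isSmoothProjective

/-- ANATOMY OF THE FRAME: `SectorComplement` is exactly "full HC on the sector ⟹ HC" (honest off-sector
HC) together with "MiddleDegreeStep ⟹ full HC on the sector" (on-sector calibration). (`→`: full HC on
the sector gives the target by the cycle conjunct at `p := m + 1`; the target gives HC by the frame, hence
full HC on the sector.) [folklore] -/
theorem sectorComplement_iff_offSector_and_calibration :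
    SectorComplement ↔
      ((∀ (m : ℕ) (X : SchemeOver ℂ), 1 ≤ m → m ≤ 2 →
          Nonempty (UnitaryBallQuotientDatum (2 * (m + 1)) X) → HodgeConjectureFor (2 * (m + 1)) X) →
        _root_.HodgeConjecture) ∧
      (MiddleDegreeStep → ∀ (m : ℕ) (X : SchemeOver ℂ), 1 ≤ m → m ≤ 2 →
          Nonempty (UnitaryBallQuotientDatum (2 * (m + 1)) X) → HodgeConjectureFor (2 * (m + 1)) X) :=
  ⟨fun hS ↦ ⟨fun hSec ↦ hS fun m X h1 h2 hD _ c hc hH ↦ (hSec m X h1 h2 hD).2 (m + 1) c hc hH,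
      fun hM ↦ sectorHC_of_hodgeConjecture (hS hM)⟩,
    fun h hM ↦ h.1 (h.2 hM)⟩

/-- Even the honest off-sector frame fails iff full HC holds on the sector AND HC fails (elsewhere):
it, too, is refutable only through a formal `¬ HC`. [folklore] -/
theorem not_offSectorFrame_iff :
    ¬ ((∀ (m : ℕ) (X : SchemeOver ℂ), 1 ≤ m → m ≤ 2 →
          Nonempty (UnitaryBallQuotientDatum (2 * (m + 1)) X) → HodgeConjectureFor (2 * (m + 1)) X) →
        _root_.HodgeConjecture) ↔
      (∀ (m : ℕ) (X : SchemeOver ℂ), 1 ≤ m → m ≤ 2 →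
          Nonempty (UnitaryBallQuotientDatum (2 * (m + 1)) X) → HodgeConjectureFor (2 * (m + 1)) X) ∧
        ¬ _root_.HodgeConjecture :=
  Classical.not_imp

/-- ON-SECTOR CALIBRATION FROM FOUR BINDERS (printed theorems, none yet a tree theorem): `hL` Lefschetz
(1,1) [Voisin I, Thm. 11.30]; `hHL` the hard-Lefschetz reduction "for `N < 2p`, HC in codimension `N - p`
⟹ HC in codimension `p`" [Voisin I, Thm. 6.25, Rem. 6.27, §11.3]; `hM` Hodge models [Serre GAGA §2 +
de Rham + Hodge]; `hBMM` HC in degree 4 on 6-dimensional compact arithmetic ball quotients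
[Bergeron–Millson–Moeglin, arXiv:1306.1515, Cor. 2 at (p, n) = (6, 2)]. With the target they give FULL HC
on the sector; the m = 1 half is the route's `FourfoldHodge`, the m = 2 half shows that the frame also
hides BMM Cor. 2 in degree 4, which is not a route item. [folklore] -/
theorem sectorHC_of_middleDegreeStep_of_binders
    (hL : ∀ (N : ℕ) (X : SchemeOver ℂ), IsSmoothProjective N X →
      ∀ c : complexBetti X (2 * 1), IsRationalClass c → IsOfHodgeType N X (2 * 1) 1 1 c →
        c ∈ algebraicClasses X 1)
    (hHL : ∀ (N : ℕ) (X : SchemeOver ℂ), IsSmoothProjective N X → ∀ p : ℕ, N < 2 * p →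
      (∀ a : complexBetti X (2 * (N - p)), IsRationalClass a →
        IsOfHodgeType N X (2 * (N - p)) (N - p) (N - p) a → a ∈ algebraicClasses X (N - p)) →
      ∀ c : complexBetti X (2 * p), IsRationalClass c → IsOfHodgeType N X (2 * p) p p c →
        c ∈ algebraicClasses X p)
    (hM : ∀ (N : ℕ) (X : SchemeOver ℂ), IsSmoothProjective N X → Nonempty (HodgeModel N X))
    (hBMM : ∀ X : SchemeOver ℂ, Nonempty (UnitaryBallQuotientDatum (2 * (2 + 1)) X) →
      ∀ a : complexBetti X (2 * 2), IsRationalClass a → IsOfHodgeType (2 * (2 + 1)) X (2 * 2) 2 2 a →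
        a ∈ algebraicClasses X 2)
    (hMid : MiddleDegreeStep) :
    ∀ (m : ℕ) (X : SchemeOver ℂ), 1 ≤ m → m ≤ 2 →
      Nonempty (UnitaryBallQuotientDatum (2 * (m + 1)) X) → HodgeConjectureFor (2 * (m + 1)) X := by
  intro m X h1 h2 hD
  obtain ⟨D⟩ := id hD
  have hX : IsSmoothProjective (2 * (m + 1)) X := D.isSmoothProjective
  refine ⟨hM _ X hX, fun p c hc hH ↦ ?_⟩
  obtain rfl | rfl : m = 1 ∨ m = 2 := by omega
  · have low : ∀ k : ℕ, k ≤ 1 → ∀ a : complexBetti X (2 * k), IsRationalClass a →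
        IsOfHodgeType (2 * (1 + 1)) X (2 * k) k k a → a ∈ algebraicClasses X k := by
      intro k hk
      interval_cases k
      · exact fun a _ _ ↦ hodgeConjectureFor_codim_zero a
      · exact hL _ X hX
    rcases Nat.lt_or_ge p 3 with hp | hp
    · interval_cases p
      · exact hodgeConjectureFor_codim_zero c
      · exact hL _ X hX c hc hH
      · exact hMid 1 X le_rfl (by norm_num) hD (hL _ X hX) c hc hH
    · exact hHL _ X hX p (by omega) (low (2 * (1 + 1) - p) (by omega)) c hc hH
  · have low : ∀ k : ℕ, k ≤ 2 → ∀ a : complexBetti X (2 * k), IsRationalClass a →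
        IsOfHodgeType (2 * (2 + 1)) X (2 * k) k k a → a ∈ algebraicClasses X k := by
      intro k hk
      interval_cases k
      · exact fun a _ _ ↦ hodgeConjectureFor_codim_zero a
      · exact hL _ X hX
      · exact hBMM X hD
    rcases Nat.lt_or_ge p 4 with hp | hp
    · interval_cases p
      · exact hodgeConjectureFor_codim_zero c
      · exact hL _ X hX c hc hH
      · exact hBMM X hD c hc hH
      · exact hMid 2 X (by norm_num) le_rfl hD (hBMM X hD) c hc hH
    · exact hHL _ X hX p (by omega) (low (2 * (2 + 1) - p) (by omega)) c hc hH

/-! ## Universality reading -/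

/-- `SectorComplement ↔ (¬ HC → ¬ MiddleDegreeStep)`: any failure of HC anywhere would be mirrored by a
failure of middle-degree propagation on a compact arithmetic 4- or 6-ball quotient — believed only
because HC is believed (conjecture-grade). [folklore] -/
theorem sectorComplement_iff_not_hc_imp :
    SectorComplement ↔ (¬ _root_.HodgeConjecture → ¬ MiddleDegreeStep) :=
  ⟨fun h hHC hM ↦ hHC (h hM), fun h hM ↦ Classical.by_contradiction fun hHC ↦ h hHC hM⟩

/-! ## The shape of any kill: dichotomy of a formal `¬ HC` -/

/-- DICHOTOMY: a refutation of the formal summit is either a smooth projective variety WITHOUT Hodge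
model (the anti-vacuity conjunct `Nonempty (HodgeModel n X)` failing — junk) or a smooth projective
variety with a rational class of Hodge type `(p,p)` outside `algebraicClasses X p` (honest). [folklore] -/
theorem not_hodgeConjecture_iff_modelless_or_honest :
    ¬ _root_.HodgeConjecture ↔
      (∃ (n : ℕ) (X : SchemeOver ℂ), IsSmoothProjective n X ∧ IsEmpty (HodgeModel n X)) ∨
      (∃ (n : ℕ) (X : SchemeOver ℂ) (p : ℕ) (c : complexBetti X (2 * p)), IsSmoothProjective n X ∧
        IsRationalClass c ∧ IsOfHodgeType n X (2 * p) p p c ∧ c ∉ algebraicClasses X p) := by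
  constructor
  · intro h
    by_contra h'
    refine h fun n X hX ↦ ⟨?_, fun p c hc hH ↦ ?_⟩
    · by_contra hA
      exact h' (Or.inl ⟨n, X, hX, not_nonempty_iff.1 hA⟩)
    · by_contra hc'
      exact h' (Or.inr ⟨n, X, p, c, hX, hc, hH, hc'⟩)
  · rintro (⟨n, X, hX, hE⟩ | ⟨n, X, p, c, hX, hc, hH, hc'⟩) hHC
    · exact not_nonempty_iff.2 hE (hHC hX).1
    · exact hc' ((hHC hX).2 p c hc hH)

/-- The junk branch is closed by the named fact `nonempty_hodgeModel` (Serre GAGA §2, de Rham's theorem,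
Hodge decomposition). [cite: SerreGAGA1956, §2] -/
theorem not_modelless_of_nonempty_hodgeModel
    (hF : ∀ (n : ℕ) (X : SchemeOver ℂ), nonempty_hodgeModel n X) :
    ¬ ∃ (n : ℕ) (X : SchemeOver ℂ), IsSmoothProjective n X ∧ IsEmpty (HodgeModel n X) := by
  rintro ⟨n, X, hX, hE⟩
  exact not_nonempty_iff.2 hE (hF n X hX)

/-- EXACT CONTENT OF A KILL modulo Hodge-model existence: the route target AND an honest non-algebraic
rational Hodge class on some smooth projective variety. [folklore] -/
theorem not_sectorComplement_iff_of_nonempty_hodgeModel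
    (hF : ∀ (n : ℕ) (X : SchemeOver ℂ), nonempty_hodgeModel n X) :
    ¬ SectorComplement ↔ MiddleDegreeStep ∧
      ∃ (n : ℕ) (X : SchemeOver ℂ) (p : ℕ) (c : complexBetti X (2 * p)), IsSmoothProjective n X ∧
        IsRationalClass c ∧ IsOfHodgeType n X (2 * p) p p c ∧ c ∉ algebraicClasses X p := by
  rw [not_sectorComplement_iff, not_hodgeConjecture_iff_modelless_or_honest]
  exact and_congr_right fun _ ↦
    ⟨fun h ↦ h.resolve_left (not_modelless_of_nonempty_hodgeModel hF), Or.inr⟩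

/-- THE ONE JUNK WORLD KILLING THE CRUX: an inhabited sector without Hodge models (target vacuous, HC
false at the datum's `isSmoothProjective`). Recorded to pin down which formal defect a cheap kill needs.
[folklore] -/
theorem not_sectorComplement_of_inhabited_modelless_sector
    (h : ∀ (m : ℕ) (X : SchemeOver ℂ), 1 ≤ m → m ≤ 2 →
      Nonempty (UnitaryBallQuotientDatum (2 * (m + 1)) X) → IsEmpty (HodgeModel (2 * (m + 1)) X))
    (hinh : ∃ (m : ℕ) (X : SchemeOver ℂ), 1 ≤ m ∧ m ≤ 2 ∧
      Nonempty (UnitaryBallQuotientDatum (2 * (m + 1)) X)) :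
    ¬ SectorComplement := by
  obtain ⟨m, X, h1, h2, hD⟩ := hinh
  refine not_sectorComplement_iff.2 ⟨?_, ?_⟩
  · -- the target is VACUOUS in a model-less sector: `IsOfHodgeType … c` is `∃ A : HodgeModel _ X, …`
    intro m' X' h1' h2' hD' _ c _ hH
    obtain ⟨A, -⟩ := hH
    exact ((h m' X' h1' h2' hD').false A).elim
  · obtain ⟨D⟩ := id hD
    exact not_hodgeConjecture_iff_modelless_or_honest.2
      (Or.inl ⟨_, X, D.isSmoothProjective, h m X h1 h2 hD⟩)

/-- … and its exclusion: under `nonempty_hodgeModel`, an inhabited sector has Hodge models, so the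
hypothesis of the junk kill is itself false. [cite: SerreGAGA1956, §2] -/
theorem not_modelless_inhabited_sector_of_nonempty_hodgeModel
    (hF : ∀ (n : ℕ) (X : SchemeOver ℂ), nonempty_hodgeModel n X)
    (hinh : ∃ (m : ℕ) (X : SchemeOver ℂ), 1 ≤ m ∧ m ≤ 2 ∧
      Nonempty (UnitaryBallQuotientDatum (2 * (m + 1)) X)) :
    ¬ ∀ (m : ℕ) (X : SchemeOver ℂ), 1 ≤ m → m ≤ 2 →
      Nonempty (UnitaryBallQuotientDatum (2 * (m + 1)) X) → IsEmpty (HodgeModel (2 * (m + 1)) X) := by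
  intro h
  obtain ⟨m, X, h1, h2, hD⟩ := hinh
  obtain ⟨D⟩ := id hD
  exact not_nonempty_iff.2 (h m X h1 h2 hD) (hF _ X D.isSmoothProjective)

/-- In an EMPTY sector (no datum at all in dimensions 4 and 6 — mathematically false, Kottwitz/Clozel,
BMM Part 2 §1, but nothing in the tree constructs a datum) the target is vacuous and the crux is literally
the summit: still no kill short of `¬ HC`. [folklore] -/
theorem sectorComplement_iff_hodgeConjecture_of_forall_isEmpty_datum
    (h : ∀ (m : ℕ) (X : SchemeOver ℂ), 1 ≤ m → m ≤ 2 →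
      IsEmpty (UnitaryBallQuotientDatum (2 * (m + 1)) X)) :
    SectorComplement ↔ _root_.HodgeConjecture :=
  ⟨fun hS ↦ hS fun m X h1 h2 hD ↦ (not_nonempty_iff.2 (h m X h1 h2) hD).elim, fun hHC _ ↦ hHC⟩

/-- For ANY target `T`, a frame `T → HC` fails iff `T ∧ ¬ HC`: the pattern shared by every sector frame of
the summit's route files. [folklore] -/
theorem not_frame_iff (T : Prop) : ¬ (T → _root_.HodgeConjecture) ↔ T ∧ ¬ _root_.HodgeConjecture :=
  Classical.not_imp

end Summit.HodgeConjecture.HodgeConjecture.Theorems.SectorComplement.Negative
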